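import Mathlib
import HarnessLib
import HarnessLib.Audit
import Summits.AtomisticToContinuum.Statement
import Literature.MathematicalPhysics.QuantumManyBody.PeriodicBoseGas
import Literature.MathematicalPhysics.QuantumManyBody.PeriodicBoseGasFourier
import HarnessLib.Audit.Status.Attr

/-!
Route: BECIroning

# Route BECIroning — a ground state cannot be feedback-cooled — E₀-free ironing of infrared phase
records gives a shell infrared bound, hence BEC

X = IroningShellBound ∧ BoundaryTransferWeak ("it suffices to show"; cards
ironing-feedback-cooling-infrared (spine) and its v2).
IroningShellBound (the IRONED SHELL BOUND, = the card's COST LEMMA K2 + LINK K1 fed through the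
E₀-free ironing inequality and summed over
dyadic shells): for every repulsive finite-range radial v there are C, ρ₀ > 0 such that for 0 < ρ <
ρ₀, all large N, some δ > 0 and every
periodic trial state Ψ on the torus of side L = (N/ρ)^{1/3} with periodicEnergy v Ψ ≤ E₀^per(N,L) +
δ, the kinetic energy carried by the
(2R+1)³ − 1 lowest non-zero plane-wave modes obeys, for every cube radius R ≥ 1 (K := 2πR/L, a =
scattering length, units ħ = 2m = 1),
  Σ_{n ∈ ℤ³, 0 < |n|_∞ ≤ R} |2πn/L|² · n_Ψ(2πn/L) ≤ C · R³ · (ρa + R²/L²)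
— O(bare chemical potential + K²) per measured mode: an exponent-2, SHELL-AVERAGED T = 0 infrared
bound whose "temperature" is μ. At R = 1
it says n_{k_min} ≤ CρaL²/4π² + C = o(N): no type-III (Casimir / Pulé–Zagrebnov) smearing of the
condensate at the scale of the box, and
dyadically no smearing at any scale down to the healing length. ShellModeCounting (support, provable
now from in-tree Plancherel and the
PROVED Dyson upper bound LSSY2005 Thm 2.2) turns it into constant-mode condensation ≥ N/2 on the
torus (the PeriodicBEC body of
stmt-AtomisticToContinuum-0826); BoundaryTransferWeak (shared crux stmt-AtomisticToContinuum-0827)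
carries torus ⇒ Dirichlet λ_max(γ) ≥ cN.
Lean: `IroningShellBound ∧ BoundaryTransferWeak`

## Assembly
Pure logic (rc 0 in Sketch.lean, axioms propext / Classical.choice / Quot.sound): fix v repulsive
finite-range; IroningShellBound gives its
body for v; ShellModeCounting turns it into the PeriodicBEC body for v; BoundaryTransferWeak gives
∃ρ₀ ∀ρ<ρ₀ HasGroundStateBEC v ρ, i.e. the
sub-problem Statement decl `BoseEinsteinCondensation` (abbrev of the Literature conjecture).
Deciding theorem (glue.lean):
`theorem closes (h1 : IroningShellBound) (h2 : ShellModeCounting) (h3 : BoundaryTransferWeak) :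
BoseEinsteinCondensation := fun v hv => h3 v hv (h2 v hv (h1 v hv))`.

Rationale: WHY THIS LINE. ENGINE (card): a ground state cannot be feedback-cooled. For any N-conserving Kraus
family ∫K_z*K_z dz = 1 and unitaries U_z, minimality of
the torus ground state Ψ₀ against the admissible mixture ∫U_zK_z|Ψ₀⟩⟨Ψ₀|K_z*U_z* dz gives GAIN :=
∫⟨K_zΨ₀,(H − U_z*HU_z)K_zΨ₀⟩ ≤ COST :=
∫⟨K_zΨ₀,HK_zΨ₀⟩ − E₀ = −½∫⟨Ψ₀,[K_z,[K_z,H]]Ψ₀⟩ — E₀ cancels, the price is a pure double-commutator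
(ordering) defect; in cone language it is the
explicit certificate family A_z = U_zK_z in ω(A*[H,A]) ≥ 0, exit (a) "minimality beyond the value
E₀" of the audited barrier
Literature.Barriers.AtomisticToContinuum.KineticGapLengthScalesNarrow. CHOICE (card): K_ẑ =
SU(M_c)-coherent RAY (heterodyne) measurement of
the M_c = (2R+1)³ coarse plane-wave modes (symbol calculus of LiebSeiringerYngvason2005 / Lieb 1973
doi:10.1007/BF01646493 / Simon1980 /
Lieb–Seiringer 2006 arXiv:math-ph/0504042 gives COST ≤ C·M_c·(ρ∫v + K²), O(μ_bare) per mode,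
L-independent), U_ẑ = e^{−iΣ_jθ_ẑ(x_j)} a
configuration-space phase, so |U_ẑΨ| = |Ψ|, the interaction cancels and GAIN(θ) = 2∫∇θ·j_ẑ −
∫|∇θ|²n_ẑ is the kinetic energy of the curl-free
part of the record-CONDITIONAL current; LINK (the physical crux: conditional currents follow the
recorded phase, GAIN* ≥ cΣ_shell k²n_k −
C′M_c(μ_bare + K²)) converts the ironing bound into IroningShellBound. ENDGAME is d = 3 mode
counting with exponent 2 at temperature μ
(KennedyLiebShastry1988 / DysonLiebSimon1978 shape; shell weight ≤ CR³L²(ρa + R²/L²)/R², dyadic sum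
∝ K_uv(a + K_uv²/ρ)N → 0 with the UV
tail paid by Dyson's bound at K_uv = √(32πρa)) — summable iff d ≥ 3, logarithmic in d = 2, vacuous
in d = 1, with no sum rule, gap or
reflection positivity. Imported areas: quantum measurement / feedback ("daemonic ergotropy",
doi:10.1038/s41534-017-0012-8) as a VARIATIONAL
DEVICE, Berezin–Lieb coherent-state symbol calculus for the cost, Helmholtz projection for the gain.
What prior routes do not do: every in-tree
IR route either WANTS an infrared bound as a black box (BECInfraredBound, exponent 1, Dirichlet),
derives it from a spectral hypothesis
(BECSectorGap, BECSectorPoincareTwoScale), from a conjectured Gaussian domination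
(BECThomsonPrinciple, closed BECGaussianDomination) or
searches certificates numerically in the same cone (BECGroundStateSOS, per-mode exponent 1); this
line names an explicit, analytically
costed certificate family and isolates the single non-algebraic input (LINK, equal-time, checkable
at one loop). Negatives index: the only
BEC negative (BECSwapAffinity.SwapJensen, stmt-3980) concerns a Jensen step on positive amplitudes —
unused here (no positivity of Ψ₀ needed).

RANKED CRUXES. #2 IroningShellBound (crux) — (cards ironing-feedback-cooling-infrared K1 + K2,
output form) for every repulsive finite-range radial v there are C, ρ₀ > 0 such that for all 0 < ρ <
ρ₀, eventually in N, there is δ > 0 with: every periodic C¹ trial state Ψ on the torus of side L =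
(N/ρ)^{1/3} with periodicEnergy v Ψ ≤ E₀^per(N,L) + δ satisfies, for every cube radius R ∈ ℕ, R ≥ 1,
Σ_{n ∈ ℤ³, 0 < |n|_∞ ≤ R} (4π²|n|²/L²) · ⟨φ_n, γ_Ψ φ_n⟩ ≤ C R³ (ρ·a + R²/L²), where φ_n = L^{-3/2}
e^{2πi n·x/L} and a = scatteringLength v (finite for finite range; hard cores allowed, then C is NOT
the Born constant ∫v/a and needs the dressed POVM of card K3). δ is chosen after N (an
exact-ground-state property; with δ before N it is false at a = 0). Consistent with Bogoliubov at
every R (IR: needs C ≳ 30; K ≳ 1/ξ: the R⁵/L² term; K → ∞: implied by T ≤ E₀ + δ); at R = 1 it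
forbids type-III smearing at scale L. [difficulty: open-problem] (why it might fail: It is 'no
quasi-condensate smearing at any scale ≥ ξ' for exact torus ground states — open; via ironing it
needs LINK (record-conditional currents carry ≥ c of the shell kinetic energy; hidden equal-time
backflow of fine modes breaks it) and, for hard cores, a dressed POVM (else C ∝ ∫v = ∞).)
[LiebSeiringerYngvason2005, LSSY2005, PitaevskiiStringari1991, KennedyLiebShastry1988,
GavoretNozieres1964, PuleZagrebnov2004, arXiv:math-ph/0504042, doi:10.1038/s41534-017-0012-8]
#3 BoundaryTransferWeak (crux) — (shared verbatim with stmt-AtomisticToContinuum-0827, routes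
BECLaplacianL1 / BECGroundStateSOS / BECStronglyRayleigh …) for each repulsive finite-range v, the
PeriodicBEC body for v (torus of side (N/ρ)^{1/3}, constant-mode occupation ≥ cN for
δ-near-minimisers, all small ρ) implies ∃ρ₀ > 0 ∀ρ ∈ (0,ρ₀) HasGroundStateBEC v ρ (Dirichlet box,
λ_max(γ) ≥ cN via condensateNumber). The ironing inequality itself is boundary-condition agnostic
(U_ẑ preserves Dirichlet data), but LINK is not: the Dirichlet condensate is the GP profile with a
healing-length wall layer, an AMPLITUDE texture carrying Σ_{|k|≤K}k²n_k ~ NK/L ≫ M_cμ at small K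
that phase unwinding cannot iron — so the mechanism runs on the torus and the transfer is a separate
crux. [difficulty: L] (why it might fail: The torus hypothesis never fires on the Dirichlet ground
state (wall energy ≫ δ above E₀^per; interior restrictions are neither periodic nor sharp-N): no
energy-comparison proof; needs a structural transfer (Neumann bracketing + mode-free λ_max ≥ tr
γ²/N) not in print.) [LSSY2005, BoccatoSeiringer2023, Basti2022, Junge2026, Robinson1976,
Fournais2020]
#9 ShellModeCounting (support) — for each repulsive finite-range v: [IroningShellBound body for v] →
[PeriodicBEC body for v, c = 1/2] (stmt-0826 shape, the hypothesis of BoundaryTransferWeak). Proof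
on paper, every input in tree: (1) Plancherel per particle slice (tsum_sq_cellFourierCoeff,
tsum_sq_grad_cellFourierCoeff of PeriodicBoseGasFourier): Σ_n n_Ψ(2πn/L) = N and Σ_n (4π²|n|²/L²)
n_Ψ = T_Ψ ≤ periodicEnergy ≤ E₀^per + δ; (2) UV: E₀^per ≤ 4πρ₁a(1 + C_D a/b)N by the PROVED
LSSY2005_upperBound_periodic_holds (a ≤ R₀ < ∞ by scatteringLength_le_range; N ≥ 2, 2R₀ < L, a/b
small all eventual), so with R_uv = the least power of 2 ≥ L√(32πρa·(1+C_D a/b))/2π the modes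
outside the cube |n|_∞ ≤ R_uv carry ≤ T L²/(4π²R_uv²) ≤ N/8 + δL²; (3) IR: on the cube shell 2^{j−1}
< |n|_∞ ≤ 2^j, k² ≥ 4π²4^{j−1}/L², so its weight is ≤ (L²/(π²4^j))·C8^j(ρa + 4^j/L²); summing j =
0…J (2^J = R_uv): Σ_{0<|n|_∞≤R_uv} n ≤ (2C/π²)ρaL²R_uv + (8C/7π²)R_uv³ ≤ C″(ρa³)^{1/2}N (ρL³ = N,
aK_uv = (32π)^{1/2}(ρa³)^{1/2}, K_uv³/ρ = (32π)^{3/2}(ρa³)^{1/2}; C″ ≈ 1.6C with the power-of-2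
rounding); (4) hence n₀ = condensateOccupation ≥ N − N/8 − C″(ρa³)^{1/2}N − δL² ≥ N/2 for ρa³ ≤
(3/(8C″))² and δ ≤ 1/L² (δ after N). a = 0 (v = 0 a.e.): T ≤ δ, take δ < 2π²/L². Heavy but routine
Lean (lattice-cube sums, tsum/Finset splitting, ENNReal bookkeeping); no open mathematics.
[difficulty: provable-now] [LSSY2005, KennedyLiebShastry1988, DysonLiebSimon1978, Fournais2020]

TWO-LAYER PLAN. Foreseen glued split (filed informally right after open as IroningLink /
IroningCost, typed once the ray-POVM vocabulary D1 lands; k = 2,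
depth 1): IroningShellBound ⇐ IroningCost (COST LEMMA: for the SU(M_c)-ray POVM on the (2R+1)³
coarse plane-wave modes of the torus ground
state, ∫dẑ⟨K_ẑΨ₀,HK_ẑΨ₀⟩ − E₀ = −½∫⟨[K_ẑ,[K_ẑ,H]]⟩ ≤ C(2R+1)³(ρ∫v + K²), incl. the coarse–fine
cubic/pairing blocks, uniformly in L)
→ IroningLink (LINK: E_ẑ sup_θ GAIN(θ) = E_ẑ∫|P_∇ j_ẑ|²/n_ẑ ≥ c·Σ_{R/2<|n|_∞≤R} k²n_k(Ψ₀) −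
C′(2R+1)³(ρ∫v + K²), c > 0 uniform in L)
→ IroningShellBound; glue = the abstract ironing inequality GAIN ≤ COST + δ (three lines: ∫‖K_zΨ‖² =
1 and the variational principle for
each U_zK_zΨ/‖K_zΨ‖; finite-dimensional version Lean-able now) + the gain formula U*HU = Σ(p_j −
∇θ(x_j))² + V + the dyadic sum of shells +
passage exact ground state ⇒ δ-near-minimisers at fixed (N, L) by compactness (finitely many R
matter since LHS ≤ T); all ride as
`--supports IroningShellBound` lemmas, never items. Hard cores (card K3: Jastrow-dressed ray POVM,
COST ≤ CM_cρa) is a third child only if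
a refuter shows the ∫v-constant is essential. ShellModeCounting ⇐ TorusPlancherelOccupations →
DyadicCubeSums → ShellModeCounting if a
prover wants it. BoundaryTransferWeak: decomposition owned by the periodic-reduction programme
(Neumann bracketing of interior boxes +
mode-free λ_max ≥ tr γ²/N), not split here.

KILL CRITERIA. ¬IroningShellBound — exact torus ground states at arbitrarily small ρ whose lowest
cube shells carry Σk²n_k ≫ R³(ρa + R²/L²) for some
R = R(N) (an infrared anomaly beyond Bogoliubov: quasi-condensate smearing) — closes the route
`refuted:IroningShellBound` (and bears on
every exponent-2 IR line). A refutation of LINK alone (e.g. the one-loop conditional-current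
correlator NOT o(1)·Σk²n_k as q → 0, or an
exact eigenstate of a repulsive finite-range H_N with generalised-not-single-mode condensation and
currentless ray records) kills the
MECHANISM but not the typed crux: pivot IroningShellBound to another certificate family in the cone
(record = pair/bond observables instead
of the coarse ray) or retire `superseded` in favour of BECGroundStateSOS. ¬BoundaryTransferWeak
kills this route together with
BECLaplacianL1 / BECGroundStateSOS / BECStronglyRayleigh (walls destroy a torus condensate), not the
conjunct. ¬ShellModeCounting can only
mean a misformalised clause (restate). PeriodicBEC (stmt-0826 body) proved by any route moots rank 2
for the assembly (close superseded)
but leaves IroningShellBound as a quantitative statement of independent interest.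

NOT DECOMPOSED YET. The typed children of IroningShellBound (IroningCost, IroningLink) wait for D1
(ray-POVM / conditional-current vocabulary over
PeriodicTrialState); the SU(M) symbol estimates for the mixed cubic blocks a_≤*a_>*a_>a_> and the
band-limit leakage of −Δ (inside
IroningCost); the weighted Helmholtz projection and the amplitude-gradient share O(M_cK²) (inside
IroningLink); the hard-core dressing
(card K3); uniqueness/realness of the torus ground state and the compactness passage to
near-minimisers (supports); window condensation
(card P1) is NOT used — Dyson's bound pays the UV tail (card P5). No T > 0, no d ≠ 3, canonical
ensemble only, no Dirichlet-box ironing.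

CHEAPEST FALSIFIER. (i) Pencil, one afternoon (card's Fastest refutation): the one-loop
(Beliaev–Popov) equal-time correlator between the fine-mode current
j_>(q) and the coarse phase gradient at 2π/L ≤ |q| ≤ K ≪ 1/ξ; LINK dies if it is not o(1)·Σ_shell
k²n_k uniformly as q → 0 (an
infrared-enhanced cubic vertex = hidden backflow). (ii) Toys: Bose–Hubbard dimer j002054 (card: gain
≤ cost holds, cost = symbol defect
≈ UN/2, gain/cost 0.0023 → 0.27 as tN/U = 0.5 → 8192, loss factor 3.7 at tN/U = 8192); ring ED jobs
j002590 / j002764 (L = 10, N = 8;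
L = 9, N = 7; SU(3) ray POVM on modes {0, ±1}) were queued by the card author — the sign of the
fine-mode contribution (co-flow vs
backflow) is the number to read. (iii) For the typed crux directly (done here, Bogoliubov): IR
regime needs C ≳ 30·(a_Born/a), healing
regime covered by the R⁵/L² term for C ≳ 2, far UV implied by T ≤ E₀ + δ — consistent at every R; v
≡ 0 true (T ≤ δ < 2π²/L²);
δ-before-N version FALSE at a = 0 (δL²/4π² particles in k_min), hence δ after N. (iv) Lookup
(Novelty): no printed shell-averaged T = 0
infrared bound or measure-and-correct variational bound for Bose gases — nothing to cite against.

NUMBERS. Units ħ = 2m = 1, μ = 8πρa, ξ = (8πρa)^{−1/2}, N = ρL³, K = 2πR/L, M_c = (2R+1)³.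
Bogoliubov: n_k ≈ √μ/(2√2|k|) (|k|ξ ≪ 1),
16π²ρ²a²/|k|⁴ (|k|ξ ≫ 1); cube sum at R = 1: Σk²n_k ≈ 100/(Lξ) vs RHS 2Cρa = C/(12.6ξ²) — true once
L ≥ 1260ξ/C; IR regime Σ_{|k|≤K}k²n_k ≈
L³√μK⁴/(16√2π²) ≤ (C/8π³)L³K³ρa iff K ≤ 0.036·C(a_B/a)/ξ (card's per-mode form: 1.9C/ξ); healing
regime 8ρ²a²KL³ ≤ CL³K⁵/8π³ iff
K ≥ 1.3C^{−1/4}/ξ. Mode counting: K_uv = √(32πρa) ≈ 10√(ρa) gives UV tail ≤ N/8 (Dyson, T ≲ 4πρaN);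
IR dyadic sum ≤ (0.32 + 0.47)·C·
(ρa³)^{1/2}N·(rounding ≤ 2); zero-point/log terms (C/π²)ρaL²·const = O(N/L) and O(C log N); so n₀ ≥
N/2 for ρa³ ≲ 0.05/C². Why NOT the
crude E₀ ≤ Cρ^{2/3}N: then K_uv ~ ρ^{1/3} and the K² (zero-point) term sums to O(N). Card toy
j002054: cost 127…190 ≈ UN/2 (N = 256,
U = 1), implied ⟨1 − cos φ⟩ bound 0.023 vs actual 0.0063 at tN/U = 8192. Items at open: 4 typed (2
cruxes, 1 support, 1 assembly) + 2
informal cruxes (IroningLink rank 4, IroningCost rank 5) + 1 definition request filed right after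
open.

DEFINITION REQUESTS. D1 (filed after open, `--kind definition`, topic
Literature/MathematicalPhysics/QuantumManyBody, for IroningLink): COARSE-MODE RAY POVM AND
RECORD-CONDITIONAL ONE-BODY DENSITIES on PeriodicTrialState N L — for a finite set S ⊂ ℤ³ of
plane-wave modes (M = |S|) and a unit vector
ẑ ∈ ℂ^S: the Kraus map K_ẑ = ⊕_m √c_m P_{ẑ}^{⊗m} ⊗ 1_{S^c} (c_m = dim Sym^m ℂ^M, so ∫K_ẑ*K_ẑ dẑ = 1
for the normalised U(M)-invariant
measure), written in first quantisation as an integral operator on L²(cell^N)_sym; the conditional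
density n_ẑ(x) and current
j_ẑ(x) = Σ_i Im(conj(K_ẑΨ) ∇_i K_ẑΨ) marginals; and the n-weighted Helmholtz projection.
Nice-to-have (non-blocking, whoever proves
ShellModeCounting): a plane-wave occupation API n_Ψ(2πn/L) := cellOccupation N L (L^{-3/2} cellWave
L n) with Σ_n n = N and
Σ_n(4π²|n|²/L²)n = T (Plancherel already in PeriodicBoseGasFourier). No cite facts wanted:
LSSY2005_upperBound_periodic and the torus
Plancherel are PROVED in tree; the symbol calculus enters only inside IroningCost's proof.

Novelty: Searches (2026-08-15, this planner; the card's and triage-21's searches are recorded on the card):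
`lit search --hybrid "measurement
feedback variational principle ground state Bose gas momentum distribution infrared bound"` (12
textbook hits: Zhai 2021, Griffin 1993,
LSSY2005 pp.39–63 — none with a measure-and-correct competitor); `lit search --source crossref
"infrared bound momentum distribution
interacting Bose gas zero temperature k^-2 chemical potential Gaussian domination without reflection
positivity"` (12: Corgini–Sankovich
1999 doi:10.1142/s0217979299002988 = GD WITH sources, Minguzzi–Vignolo–Tosi 2000 — physics of n_k;
no averaged T = 0 bound);
`lit search --source crossref "ergotropy measurement feedback work extraction many-body"` (8:
doi:10.1038/s41534-017-0012-8 and quantum-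
battery papers — QI only); `lit galaxy search "Berezin-Lieb inequality" --star all` (11:
Lewin–Nam–Rougerie Gibbs-measure / classical-
field papers, LSSY book, Safarov — symbols for pressures and semiclassics, never for order); `lit
galaxy search "feedback cooling ground
state variational" --star all` (0); `lit frontier AtomisticToContinuum --since 2021` (30 rows; BEC
rows arXiv:2510.20493, 2603.20776,
2605.06844, 2602.16566 — gap/localisation/trial-state papers); `lit bridges AtomisticToContinuum
--cross any` (no Bose-gas bridge);
`ledger negatives` (1 BEC negative, unrelated); in-tree: 18 open BEC routes read by decl list, no
Theses file mentions Kraus/POVM/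
heterodyne/unwinding; nearest  [refs: 10.1142/s0217979299002988, 10.1038/s41534-017-0012-8, 2510.20493, math-ph/0412034, math-ph/0504042, doi:10.1142/s0217979299002988, doi:10.1038/s41534-017-0012-8, LSSY2005, LiebSeiringerYngvason2005, PitaevskiiStringari1991, Wagner1966, KennedyLiebShastry1988, DysonLiebSimon1978]

Barriers (technique_class: measure-and-unwind-variational, coherent-state-symbols): - technique_class: measure-and-unwind-variational, coherent-state-symbols, infrared-bound,
mode-counting
- Literature.Barriers.AtomisticToContinuum.KineticGapLengthScales: evaded — no Poincaré/gap
inequality at scale L anywhere; the ironing inequality compares Ψ₀ with a competitor built from Ψ₀,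
so E₀ cancels and the loss is M_c·μ per scale, not L²×(energy precision); Dyson's upper bound is
used only for the UV tail |k| > √(32πρa).
- Literature.Barriers.AtomisticToContinuum.KineticGapLengthScalesNarrow: outside the ENERGY-WINDOW
class by construction — δ is chosen AFTER N (below the boost witnesses 4π²N/L²; a boosted or
phase-modulated ground state is not a minimiser and its record unwinds with gain ≫ COST), and the
proof uses the MINIMALITY of Ψ₀ beyond the value E₀ (exit (a) of the audit, here a whole measured
family of certificates A_z = U_zK_z); honest residue: a prover who tries rank 2 from an o(N) energy
window alone is blocked.
- Literature.Barriers.AtomisticToContinuum.EnergyAsymptoticsWithoutCondensation: respected — no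
energy asymptotics are matched, LHY never enters; only the crude Dyson bound T ≲ 4πρaN pays the UV
tail.
- Literature.Barriers.AtomisticToContinuum.BogoliubovPerturbationInfrared: no expansion around the
Bogoliubov state — each shell bound is non-perturbative and the dyadic sum is geometric in d = 3;
perturbation theory appears only as the falsifier of LINK. Honest: if LINK can be reached only
perturbatively, the barrier bites there.
- Literature.Barr

History (route lifecycle, newest last):
- 2026-08-25T00:43:08Z · DORMANT — reconciler: no traction for 7.2 d (last activity item-evidence-added at 2026-08-17T18:55:01Z); parked, not closed — `ledger route dormant route-AtomisticToConti (operator:999:771425)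
- 2026-08-29T03:20:08Z · REACTIVATED — reconciler: reactivated — activity statement-checked at 2026-08-29T01:17:37Z after parking at 2026-08-25T00:43:08Z (operator:999:3962964)

sub-problem: BoseEinsteinCondensation · status: open · opened planner-plancard-AtomisticToContinuum-BoseEin-7850e50a-0 2026-08-15T17:44:09Z · rev 2 · ledger route-AtomisticToContinuum-BECIroning
GENERATED by the gate from the ledger (D-0016/17). Provers cite these decls: `theorem foo : Summit.AtomisticToContinuum.BoseEinsteinCondensation.Theses.BECIroning.<Decl> := …` in Summits/AtomisticToContinuum/BoseEinsteinCondensation/Theorems/<Name>.lean.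
-/

namespace Summit.AtomisticToContinuum.BoseEinsteinCondensation.Theses.BECIroning

open scoped BigOperators Topology Manifold Classical MeasureTheory ProbabilityTheory Matrix InnerProductSpace ComplexConjugate ContinuousMap
open Filter Set Function TopologicalSpace MeasureTheory

attribute [summit_statement] _root_.BoseEinsteinCondensation

/-- item stmt-AtomisticToContinuum-11429 · crux · rank 2 · open · by planner
why it might fail: Exponent-2 TD-limit shell IR bound for dilute torus ground states: stronger than torus BEC, itself open (only L ≲ (ρa)^{-1/2}(ρa³)^{-δ}, δ<1/4 proved: Fournais2020 Thm 1.2); via ironing it needs the unproved LINK (conditional currents follow the phase record) and, for hard cores, a dressed POVM.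
sources: LSSY2005, Fournais2020, LiebSeiringer2002, PitaevskiiStringari1991, KLS1988PRL, PuleZagrebnov2004
[crux] (cards ironing-feedback-cooling-infrared K1 + K2, output form) for every repulsive
finite-range radial v there are C, ρ₀ > 0 such that for all 0 < ρ < ρ₀, eventually in N, there is δ
> 0 with: every periodic C¹ trial state Ψ on the torus of side L = (N/ρ)^{1/3} with periodicEnergy v
Ψ ≤ E₀^per(N,L) + δ satisfies, for every cube radius R ∈ ℕ, R ≥ 1, Σ_{n ∈ ℤ³, 0 < |n|_∞ ≤ R}
(4π²|n|²/L²) · ⟨φ_n, γ_Ψ φ_n⟩ ≤ C R³ (ρ·a + R²/L²), where φ_n = L^{-3/2} e^{2πi n·x/L} and a =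
scatteringLength v (finite for finite range; hard cores allowed, then C is NOT the Born constant
∫v/a and needs the dressed POVM of card K3). δ is chosen after N (an exact-ground-state property;
with δ before N it is false at a = 0). Consistent with Bogoliubov at every R (IR: needs C ≳ 30; K ≳
1/ξ: the R⁵/L² term; K → ∞: implied by T ≤ E₀ + δ); at R = 1 it forbids type-III smearing at scale
L. [difficulty: open-problem] -/
@[route_item "route-AtomisticToContinuum-BECIroning", crux]
def IroningShellBound : Prop :=
  ∀ v : ℝ → ENNReal, Literature.MathematicalPhysics.QuantumManyBody.BoseGas.IsRepulsiveFiniteRange v → ∃ C : ℝ, 0 < C ∧ ∃ ρ₀ : ℝ, 0 < ρ₀ ∧ ∀ ρ : ℝ, 0 < ρ → ρ < ρ₀ → ∀ᶠ N : ℕ in Filter.atTop, ∃ δ : ENNReal, 0 < δ ∧ ∀ Ψ : Literature.MathematicalPhysics.QuantumManyBody.BoseGas.PeriodicTrialState N (Literature.MathematicalPhysics.QuantumManyBody.BoseGas.sideLength ρ N), Literature.MathematicalPhysics.QuantumManyBody.BoseGas.periodicEnergy v Ψ ≤ Literature.MathematicalPhysics.QuantumManyBody.BoseGas.periodicGroundStateEnergy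 v N (Literature.MathematicalPhysics.QuantumManyBody.BoseGas.sideLength ρ N) + δ → ∀ R : ℕ, 1 ≤ R → (∑ n ∈ (Finset.Icc (fun _ : Fin 3 => -(R : ℤ)) (fun _ : Fin 3 => (R : ℤ))).erase 0, ENNReal.ofReal (4 * Real.pi ^ 2 * (∑ j, (n j : ℝ) ^ 2) / Literature.MathematicalPhysics.QuantumManyBody.BoseGas.sideLength ρ N ^ 2) * Literature.MathematicalPhysics.QuantumManyBody.BoseGas.cellOccupation N (Literature.MathematicalPhysics.QuantumManyBody.BoseGas.sideLength ρ N) (fun x => ((Real.sqrt (Literature.MathematicalPhysics.QuantumManyBody.BoseGas.sideLength ρ N ^ 3))⁻¹ : ℂ) * Literature.MathematicalPhysics.QuantumManyBody.BoseGas.cellWave (Literature.MathematicalPhysics.QuantumManyBody.BoseGas.sideLength ρ N) n x) Ψ.ψ) ≤ ENNReal.ofReal (C * (R : ℝ) ^ 3 * (ρ * (Literature.MathematicalPhysics.QuantumManyBody.BoseGas.scatteringLength v).toReal + (R : ℝ) ^ 2 / Literature.MathematicalPhysics.QuantumManyBody.BoseGas.sideLength ρ N ^ 2))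

/-- item stmt-AtomisticToContinuum-0827 · crux · rank 3 · open · by planner
why it might fail: Torus hypothesis never fires on the Dirichlet ground state (wall energy ≫ δ above E₀^per; interior restrictions not periodic/sharp-N): no energy comparison; print transfers only the ENERGY across b.c. (LSSY2005 Ch.2) — a condensate transfer (Neumann bracketing + λ_max ≥ tr γ²/N) is not in print.
sources: LiebSeiringerSolovejYngvason2005, Junge2026, BoccatoSeiringer2023, Basti2022
[crux] BoundaryTransferWeak (mode-free boundary-condition transfer, per potential): for each
repulsive finite-range v, PeriodicBEC(v) implies ∃ρ₀>0 ∀ρ∈(0,ρ₀) HasGroundStateBEC v ρ (Dirichlet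
ground state, λ_max(γ) ≥ cN via condensateNumber). Not glue: near-minimiser slacks are O(N/L²) while
Dirichlet/periodic energies differ by a boundary term ≫ N/L², so no energy-comparison proof;
expected route: Neumann bracketing of interior sub-boxes (−Δ_Dir ≥ ⊕−Δ_Neu, v ≥ 0) + a mode-free
criterion (λ_max ≥ tr γ²/N). Only the ENERGY analogue is in print (LiebSeiringerSolovejYngvason2005
Ch. 2 after (2.8)). v ≡ 0: hypothesis and conclusion both true. -/
@[route_item "route-AtomisticToContinuum-BECIroning", crux]
def BoundaryTransferWeak : Prop :=
  ∀ v : ℝ → ENNReal, Literature.MathematicalPhysics.QuantumManyBody.BoseGas.IsRepulsiveFiniteRange v → (∃ ρ₀ : ℝ, 0 < ρ₀ ∧ ∀ ρ : ℝ, 0 < ρ → ρ < ρ₀ → ∃ c : ℝ, 0 < c ∧ ∀ᶠ N : ℕ in Filter.atTop, ∃ δ : ENNReal, 0 < δ ∧ ∀ Ψ : Literature.MathematicalPhysics.QuantumManyBody.BoseGas.PeriodicTrialState N (Literature.MathematicalPhysics.QuantumManyBody.BoseGas.sideLength ρ N), Literature.MathematicalPhysics.QuantumManyBody.BoseGas.periodicEnergy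 v Ψ ≤ Literature.MathematicalPhysics.QuantumManyBody.BoseGas.periodicGroundStateEnergy v N (Literature.MathematicalPhysics.QuantumManyBody.BoseGas.sideLength ρ N) + δ → ENNReal.ofReal (c * N) ≤ Literature.MathematicalPhysics.QuantumManyBody.BoseGas.condensateOccupation N (Literature.MathematicalPhysics.QuantumManyBody.BoseGas.sideLength ρ N) Ψ.ψ) → ∃ ρ₀ : ℝ, 0 < ρ₀ ∧ ∀ ρ : ℝ, 0 < ρ → ρ < ρ₀ → Literature.MathematicalPhysics.QuantumManyBody.BoseGas.HasGroundStateBEC v ρ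

-- item stmt-AtomisticToContinuum-11438 · support · rank 4 · open · by planner — informal only, no Lean statement yet:
--   [crux] IroningLink (card ironing-feedback-cooling-infrared K1 = LINK; layer-2 child of
--   IroningShellBound, untyped until the ray-POVM / conditional-current vocabulary D1 lands). Setting:
--   torus of side L = (N/ρ)^{1/3}, exact periodic ground state Ψ₀ (δ-near-minimisers, δ after N), coarse
--   set S_R = {n ∈ ℤ³ : |n|_∞ ≤ R} of M = (2R+1)³ plane-wave modes (zero mode included), K = 2πR/L. For
--   the SU(M)-coherent RAY (heterodyne) POVM K_ẑ = ⊕_m √c_m P_ẑ^{⊗m} ⊗ 1_{fine} (ẑ ∈ unit sphere of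
--   ℂ^{S_R}, c_m = dim Sym^m ℂ^M, ∫K_ẑ*K_ẑ dẑ = 1; it records relative amplitudes/phases of the coarse
--   field but neither

-- item stmt-AtomisticToContinuum-11439 · support · rank 5 · open · by planner — informal only, no Lean statement yet:
--   [crux] IroningCost (card ironing-feedback-cooling-infrared K2 = COST LEMMA; layer-2 child of
--   IroningShellBound, untyped until D1 lands). Same setting and SU(M)-ray POVM K_ẑ on the M = (2R+1)³
--   coarse plane-wave modes as IroningLink. CLAIM: for integrable repulsive finite-range v there is C
--   (depending on v only, NOT on L, N, R) such that for ρ < ρ₀(v), all large N and all R ≥ 1, COST :=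
--   ∫dẑ ⟨K_ẑΨ₀, H K_ẑΨ₀⟩ − E₀ = −½∫dẑ ⟨Ψ₀,[K_ẑ,[K_ẑ,H]]Ψ₀⟩ ≤ C·(2R+1)³·(ρ∫v + K²), K = 2πR/L — the
--   measurement back-action energy is a pure operator-ORDERING (upper-vs-lower symbol) defect, O(bare
--   chemical potential

/-- item stmt-AtomisticToContinuum-11430 · support · rank 9 · closed · proved by Summit.AtomisticToContinuum.BoseEinsteinCondensation.Theorems.ShellModeCounting_proof (prover) · by planner
sources: LSSY2005, KennedyLiebShastry1988, DysonLiebSimon1978, Fournais2020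
[support] for each repulsive finite-range v: [IroningShellBound body for v] → [PeriodicBEC body for
v, c = 1/2] (stmt-0826 shape, the hypothesis of BoundaryTransferWeak). Proof on paper, every input
in tree: (1) Plancherel per particle slice (tsum_sq_cellFourierCoeff, tsum_sq_grad_cellFourierCoeff
of PeriodicBoseGasFourier): Σ_n n_Ψ(2πn/L) = N and Σ_n (4π²|n|²/L²) n_Ψ = T_Ψ ≤ periodicEnergy ≤
E₀^per + δ; (2) UV: E₀^per ≤ 4πρ₁a(1 + C_D a/b)N by the PROVED LSSY2005_upperBound_periodic_holds (a
≤ R₀ < ∞ by scatteringLength_le_range; N ≥ 2, 2R₀ < L, a/b small all eventual), so with R_uv = the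
least power of 2 ≥ L√(32πρa·(1+C_D a/b))/2π the modes outside the cube |n|_∞ ≤ R_uv carry ≤ T
L²/(4π²R_uv²) ≤ N/8 + δL²; (3) IR: on the cube shell 2^{j−1} < |n|_∞ ≤ 2^j, k² ≥ 4π²4^{j−1}/L², so
its weight is ≤ (L²/(π²4^j))·C8^j(ρa + 4^j/L²); summing j = 0…J (2^J = R_uv): Σ_{0<|n|_∞≤R_uv} n ≤
(2C/π²)ρaL²R_uv + (8C/7π²)R_uv³ ≤ C″(ρa³)^{1/2}N (ρL³ = N, aK_uv = (32π)^{1/2}(ρa³)^{1/2}, K_uv³/ρ =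
(32π)^{3/2}(ρa³)^{1/2}; C″ ≈ 1.6C with the power-of-2 rounding); (4) hence n₀ = condensateOccupation
≥ N − N/8 − C″(ρa³)^{1/2}N − δL² ≥ N/2 for ρa³ ≤ (3/(8C″))² and δ ≤ 1/L² (δ after N). a = 0 (v = 0
a.e.): T ≤ -/
@[route_item "route-AtomisticToContinuum-BECIroning", crux]
def ShellModeCounting : Prop :=
  ∀ v : ℝ → ENNReal, Literature.MathematicalPhysics.QuantumManyBody.BoseGas.IsRepulsiveFiniteRange v → (∃ C : ℝ, 0 < C ∧ ∃ ρ₀ : ℝ, 0 < ρ₀ ∧ ∀ ρ : ℝ, 0 < ρ → ρ < ρ₀ → ∀ᶠ N : ℕ in Filter.atTop, ∃ δ : ENNReal, 0 < δ ∧ ∀ Ψ : Literature.MathematicalPhysics.QuantumManyBody.BoseGas.PeriodicTrialState N (Literature.MathematicalPhysics.QuantumManyBody.BoseGas.sideLength ρ N), Literature.MathematicalPhysics.QuantumManyBody.BoseGas.periodicEnergy v Ψ ≤ Literature.MathematicalPhysics.QuantumManyBody.BoseGas.periodicGroundStateEnergy v N (Literature.MathematicalPhysics.QuantumManyBody.BoseGas.sideLength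 ρ N) + δ → ∀ R : ℕ, 1 ≤ R → (∑ n ∈ (Finset.Icc (fun _ : Fin 3 => -(R : ℤ)) (fun _ : Fin 3 => (R : ℤ))).erase 0, ENNReal.ofReal (4 * Real.pi ^ 2 * (∑ j, (n j : ℝ) ^ 2) / Literature.MathematicalPhysics.QuantumManyBody.BoseGas.sideLength ρ N ^ 2) * Literature.MathematicalPhysics.QuantumManyBody.BoseGas.cellOccupation N (Literature.MathematicalPhysics.QuantumManyBody.BoseGas.sideLength ρ N) (fun x => ((Real.sqrt (Literature.MathematicalPhysics.QuantumManyBody.BoseGas.sideLength ρ N ^ 3))⁻¹ : ℂ) * Literature.MathematicalPhysics.QuantumManyBody.BoseGas.cellWave (Literature.MathematicalPhysics.QuantumManyBody.BoseGas.sideLength ρ N) n x) Ψ.ψ) ≤ ENNReal.ofReal (C * (R : ℝ) ^ 3 * (ρ * (Literature.MathematicalPhysics.QuantumManyBody.BoseGas.scatteringLength v).toReal + (R : ℝ) ^ 2 / Literature.MathematicalPhysics.QuantumManyBody.BoseGas.sideLength ρ N ^ 2))) → ∃ ρ₀ : ℝ, 0 < ρ₀ ∧ ∀ ρ : ℝ,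 0 < ρ → ρ < ρ₀ → ∃ c : ℝ, 0 < c ∧ ∀ᶠ N : ℕ in Filter.atTop, ∃ δ : ENNReal, 0 < δ ∧ ∀ Ψ : Literature.MathematicalPhysics.QuantumManyBody.BoseGas.PeriodicTrialState N (Literature.MathematicalPhysics.QuantumManyBody.BoseGas.sideLength ρ N), Literature.MathematicalPhysics.QuantumManyBody.BoseGas.periodicEnergy v Ψ ≤ Literature.MathematicalPhysics.QuantumManyBody.BoseGas.periodicGroundStateEnergy v N (Literature.MathematicalPhysics.QuantumManyBody.BoseGas.sideLength ρ N) + δ → ENNReal.ofReal (c * N) ≤ Literature.MathematicalPhysics.QuantumManyBody.BoseGas.condensateOccupation N (Literature.MathematicalPhysics.QuantumManyBody.BoseGas.sideLength ρ N) Ψ.ψ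

-- `ShellModeCounting` holds: proved by `Summit.AtomisticToContinuum.BoseEinsteinCondensation.Theorems.ShellModeCounting_proof` (its module imports this route file, so no `_holds` link can be stated here).

/-- item stmt-AtomisticToContinuum-11431 · assembly · rank 1 · closed · proved by Summit.AtomisticToContinuum.BoseEinsteinCondensation.Theorems.becIroning_assembly_proof (prover) · by planner
sources: LSSY2005, KennedyLiebShastry1988
[assembly] IroningShellBound → ShellModeCounting → BoundaryTransferWeak → BoseEinsteinCondensation. -/
@[route_item "route-AtomisticToContinuum-BECIroning"]
def Assembly : Prop :=
  IroningShellBound → ShellModeCounting → BoundaryTransferWeak → BoseEinsteinCondensation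

-- `Assembly` holds: proved by `Summit.AtomisticToContinuum.BoseEinsteinCondensation.Theorems.becIroning_assembly_proof` (its module imports this route file, so no `_holds` link can be stated here).

/-! D-0027 §2.1 — DECIDING THEOREM (planner-authored via `route open/edit --closes-file`; by planner-plancard-AtomisticToContinuum-BoseEin-7850e50a-0 2026-08-15T17:44:10Z):
its hypotheses are this route's items and its conclusion the sub-problem Statement (glue_lint), and it elaborates with this file. -/

@[closes "route-AtomisticToContinuum-BECIroning"] theorem closes (h1 : IroningShellBound) (h2 : ShellModeCounting) (h3 : BoundaryTransferWeak) : BoseEinsteinCondensation :=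
  fun v hv => h3 v hv (h2 v hv (h1 v hv))

end Summit.AtomisticToContinuum.BoseEinsteinCondensation.Theses.BECIroning
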